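import Literature.AlgebraicTopology.SingularHomology.CohomologyMayerVietorisInjective
import HarnessLib

/-!
# Mayer–Vietoris for singular cohomology: gluing classes that agree on the overlap

A. Hatcher, *Algebraic Topology* (2002), §3.1, pp. 203–204: in the Mayer–Vietoris sequence of
an open cover `X = A ∪ B`, exactness at `Hᵖ(A) ⊕ Hᵖ(B)` says that two classes `a ∈ Hᵖ(A)`,
`b ∈ Hᵖ(B)` with the same restriction to `A ∩ B` are the restrictions of one class on `X`.
The tree proves this for the cohomology of subsets computed in the cochains of `X`
(`subsetCochains.exists_of_res_eq_res`); this file transports it to `singularCohomology` of the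
subspaces through the natural comparison
(`subsetCochains.homologyIsoSingularCohomology_hom_resH`, `CohomologyMayerVietorisInjective`):

* `singularCohomology.exists_of_map_inclusion_eq` — the gluing statement;
* `singularCohomology.exists_map_subsetIncl_eq_of_isZero` — if moreover `Hᵖ(B) → Hᵖ(A ∩ B)`
  hits only `0` because `Hᵖ(A ∩ B) = 0`, every class on `A` extends to `X`.

Everything is proved; no named facts.

## References

* A. Hatcher, *Algebraic Topology*, CUP 2002, §3.1 pp. 203–204. [HatcherAT2002]
-/

noncomputable section

open CategoryTheory Limits Set

universe u

namespace Literature.AlgebraicTopology.SingularHomology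

/-- Elements of a zero module vanish. [folklore] -/
theorem ModuleCat.eq_zero_of_isZero_obj {R : Type u} [Ring R] {V : ModuleCat.{u} R} (h : IsZero V)
    (x : V) : x = 0 := by
  have h1 : (𝟙 V : V ⟶ V) = 0 := h.eq_of_src _ _
  have h2 : (𝟙 V : V ⟶ V) x = (0 : V ⟶ V) x := by rw [h1]
  rw [ModuleCat.id_apply] at h2
  rw [h2]
  rfl

namespace singularCohomology

variable (R : Type u) [CommRing R] {X : Type u} [TopologicalSpace X]

/-- **Gluing cohomology classes over an open cover** (Hatcher 2002, §3.1 pp. 203–204,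
exactness of Mayer–Vietoris at `Hᵖ(A) ⊕ Hᵖ(B)`): for `A`, `B` open with `A ∪ B = X` and classes
`a ∈ Hᵖ(↥A; R)`, `b ∈ Hᵖ(↥B; R)` with equal restrictions to `↥(A ∩ B)`, there is
`c ∈ Hᵖ(X; R)` restricting to `a` on `A` and to `b` on `B`. [cite: HatcherAT2002, §3.1 pp. 203–204] -/
theorem exists_of_map_inclusion_eq {A B : Set X} (hA : IsOpen A) (hB : IsOpen B)
    (hAB : A ∪ B = univ) {p : ℕ} (a : singularCohomology R R (↥A) p)
    (b : singularCohomology R R (↥B) p)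
    (h : map R R (ContinuousMap.inclusion (inter_subset_left : A ∩ B ⊆ A)) p a =
      map R R (ContinuousMap.inclusion (inter_subset_right : A ∩ B ⊆ B)) p b) :
    ∃ c : singularCohomology R R X p,
      map R R (subsetIncl A) p c = a ∧ map R R (subsetIncl B) p c = b := by
  set S : Set X := A ∪ B with hS
  -- transport `a`, `b` to the cohomology computed in `C(X)`
  set a' := (subsetCochains.homologyIsoSingularCohomology R A p).inv a with ha'
  set b' := (subsetCochains.homologyIsoSingularCohomology R B p).inv b with hb'
  have haS : (subsetCochains.homologyIsoSingularCohomology R A p).hom a' = a := by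
    rw [ha', ← ModuleCat.comp_apply, Iso.inv_hom_id, ModuleCat.id_apply]
  have hbS : (subsetCochains.homologyIsoSingularCohomology R B p).hom b' = b := by
    rw [hb', ← ModuleCat.comp_apply, Iso.inv_hom_id, ModuleCat.id_apply]
  have hres : subsetCochains.resH inter_subset_left p a' = subsetCochains.resH inter_subset_right p b' := by
    apply ((forget (ModuleCat R)).mapIso
      (subsetCochains.homologyIsoSingularCohomology R (A ∩ B) p)).toEquiv.injective
    change (subsetCochains.homologyIsoSingularCohomology R (A ∩ B) p).hom _ =
      (subsetCochains.homologyIsoSingularCohomology R (A ∩ B) p).hom _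
    rw [subsetCochains.homologyIsoSingularCohomology_hom_resH, haS,
      subsetCochains.homologyIsoSingularCohomology_hom_resH, hbS]
    exact h
  obtain ⟨d, hdA, hdB⟩ := subsetCochains.exists_of_res_eq_res (R := R) hA hB a' b' hres
  -- `d` lives on `S = A ∪ B = X`; transport it to `X` along the homeomorphism `↥S ≃ X`
  let e : ↥S ≃ₜ X := (Homeomorph.setCongr hAB).trans (Homeomorph.Set.univ X)
  have he : (e : C(↥S, X)) = subsetIncl S := rfl
  set dS := (subsetCochains.homologyIsoSingularCohomology R S p).hom d with hdS
  refine ⟨map R R (e.symm : C(X, ↥S)) p dS, ?_, ?_⟩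
  · have h1 : (subsetIncl A : C(↥A, X)) =
        (e : C(↥S, X)).comp (ContinuousMap.inclusion (subset_union_left : A ⊆ S)) := rfl
    rw [h1, ← ModuleCat.comp_apply, ← map_comp, ← ContinuousMap.comp_assoc]
    have h2 : ((e.symm : C(X, ↥S)).comp (e : C(↥S, X))) = ContinuousMap.id _ := by
      ext x; exact congrArg Subtype.val (e.symm_apply_apply x)
    rw [h2, ContinuousMap.id_comp, ← subsetCochains.homologyIsoSingularCohomology_hom_resH, hdA, haS]
  · have h1 : (subsetIncl B : C(↥B, X)) =
        (e : C(↥S, X)).comp (ContinuousMap.inclusion (subset_union_right : B ⊆ S)) := rfl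
    rw [h1, ← ModuleCat.comp_apply, ← map_comp, ← ContinuousMap.comp_assoc]
    have h2 : ((e.symm : C(X, ↥S)).comp (e : C(↥S, X))) = ContinuousMap.id _ := by
      ext x; exact congrArg Subtype.val (e.symm_apply_apply x)
    rw [h2, ContinuousMap.id_comp, ← subsetCochains.homologyIsoSingularCohomology_hom_resH, hdB, hbS]

/-- **Classes extend across an acyclic overlap** (Hatcher 2002, §3.1 pp. 203–204): for `A`, `B`
open with `A ∪ B = X` and `Hᵖ(↥(A ∩ B); R) = 0`, every class on `↥A` is the restriction of a
class on `X` (which moreover vanishes on `B`). [cite: HatcherAT2002, §3.1 pp. 203–204] -/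
theorem exists_map_subsetIncl_eq_of_isZero {A B : Set X} (hA : IsOpen A) (hB : IsOpen B)
    (hAB : A ∪ B = univ) {p : ℕ} (hZ : IsZero (singularCohomology R R (↥(A ∩ B)) p))
    (a : singularCohomology R R (↥A) p) :
    ∃ c : singularCohomology R R X p,
      map R R (subsetIncl A) p c = a ∧ map R R (subsetIncl B) p c = 0 := by
  refine exists_of_map_inclusion_eq R hA hB hAB a 0 ?_
  rw [map_zero]
  exact ModuleCat.eq_zero_of_isZero_obj hZ _

end singularCohomology

end Literature.AlgebraicTopology.SingularHomology
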